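import Literature.AlgebraicGeometry.Resolution.KnafKuhlmann2009HenselianRationalityEtale
import HarnessLib

/-!
# The standard-étale chart of a Hensel root, realized in the field — with its normal form

Topic: `Literature/AlgebraicGeometry/Resolution` (valued function fields). A re-export of the
construction of `exists_standardEtale_model_subring` (`KnafKuhlmann2009HenselianRationalityEtale.lean`:
Knaf–Kuhlmann 2009, Lemma 3.7 (2) "⇐ is obvious", made explicit — the standard-étale algebra
`B[η]_{g(η)} ≅ (B[X]/(f))_g` over a subring `B` of the valued field `(Ω, V)`) recording what the
algebraization step of M. Temkin, *Inseparable local uniformization*, J. Algebra 373 (2013),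
Thm. 3.3.1 needs in addition (tree: `Temkin2013RelativeCurveSmoothFibre`; the `m`-side étale chart
of the common smooth roof): the chart `A ⊆ Ω` is ÉTALE over the base (not only finitely presented and formally smooth),
contains `g(η)⁻¹`, and every element of `A` has the normal form `q(η)/g(η)ⁿ`; and the base is
any commutative ring `R` mapping into `O_V` (so that it applies verbatim to a base
which is itself a subalgebra of `Ω` over the constants).

* `exists_standardEtale_chart` — PROVED (the proof is that of
  `exists_standardEtale_model_subring`, with the extra bookkeeping).

All statements are [folklore] given the cited result; no definitions, no named facts.

## Sources

* H. Knaf, F.-V. Kuhlmann, Adv. Math. 221 (2009) = arXiv:math/0702856, Lemma 3.7 (2); The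
  Stacks Project, Tag 00UB (standard étale algebras), through Mathlib (`StandardEtalePair`).
* M. Temkin, arXiv:0804.1554v3, proof of Thm. 3.3.1, Steps 3–4 (the use).
-/

noncomputable section

namespace Literature.AlgebraicGeometry.Resolution

universe u

open Polynomial

variable {Ω : Type u} [Field Ω]

/-- **The standard-étale chart with its normal form.** Let `R` be a commutative ring mapping
into the valuation ring `O_V ⊆ Ω`, `η ∈ O_V`, `f ∈ R[X]` monic with `f(η) = 0` and
of least degree among the non-zero polynomials over `R` vanishing at `η`, and
`f'h + f p₂ = gˢ` in `R[X]` with `g(η)` a unit of `O_V`. Then there is an `R`-subalgebra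
`A ⊆ O_V` of `Ω`, ÉTALE over `R`, containing `q(η)` for every `q` over `R` and `g(η)⁻¹`, all of
whose elements are of the form `q(η)/g(η)ⁿ`. (For `R` a subring of `Ω` this is the
construction of `exists_standardEtale_model_subring`.) [cite: KnafKuhlmann2009, Lemma 3.7 (2)] -/
theorem exists_standardEtale_chart (V : ValuationSubring Ω) {R : Type u} [CommRing R] [Algebra R Ω]
    (hRV : ∀ r : R, algebraMap R Ω r ∈ V)
    {η : Ω} (hηV : η ∈ V)
    (fB gB hB p₂B : Polynomial R) (s : ℕ) (hfBmon : fB.Monic)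
    (hfBη : Polynomial.aeval η fB = 0)
    (hfBmin : ∀ q : Polynomial R, q ≠ 0 → Polynomial.aeval η q = 0 → fB.natDegree ≤ q.natDegree)
    (hidentB : Polynomial.derivative fB * hB + fB * p₂B = gB ^ s)
    (hvg : V.valuation (Polynomial.aeval η gB) = 1) :
    ∃ (A : Subalgebra R Ω), A.toSubring ≤ V.toSubring ∧ Algebra.Etale R A ∧
      (∀ q : Polynomial R, Polynomial.aeval η q ∈ A) ∧ (Polynomial.aeval η gB)⁻¹ ∈ A ∧
      ∀ w ∈ A, ∃ (q : Polynomial R) (n : ℕ), w = Polynomial.aeval η q / Polynomial.aeval η gB ^ n := by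
  classical
  have hgη0 : Polynomial.aeval η gB ≠ 0 := fun h0 => by
    rw [h0, map_zero] at hvg
    exact zero_ne_one hvg
  -- the kernel of `X ↦ η` on `R[X]` is `(fB)`: monic division and minimality
  have hdvd : ∀ q : Polynomial R, Polynomial.aeval η q = 0 → fB ∣ q := by
    intro q hq
    have hmod : Polynomial.aeval η (q %ₘ fB) = 0 := by
      have h := Polynomial.modByMonic_add_div q fB
      have h' : Polynomial.aeval η (q %ₘ fB + fB * (q /ₘ fB)) = Polynomial.aeval η q :=
        congrArg (Polynomial.aeval η) h
      rw [map_add, map_mul, hfBη, zero_mul, add_zero, hq] at h'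
      exact h'
    have hzero : q %ₘ fB = 0 := by
      by_contra hne
      have h1 := hfBmin _ hne hmod
      have h2 : (q %ₘ fB).natDegree < fB.natDegree := by
        have hfB1 : fB ≠ 1 := by
          intro h1'
          rw [h1', map_one] at hfBη
          exact one_ne_zero hfBη
        exact Polynomial.natDegree_modByMonic_lt q hfBmon hfB1
      exact absurd h1 (not_le.mpr h2)
    exact (Polynomial.modByMonic_eq_zero_iff_dvd hfBmon).mp hzero
  -- `φ₀ : R[X]/(f) → Ω`, `X ↦ η`, injective
  let φ₀ : AdjoinRoot fB →ₐ[R] Ω := AdjoinRoot.liftAlgHom fB (Algebra.ofId R Ω) η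
    (by rw [Algebra.toRingHom_ofId, ← Polynomial.aeval_def]; exact hfBη)
  have hφ₀mk : ∀ q : Polynomial R, φ₀ (AdjoinRoot.mk fB q) = Polynomial.aeval η q := fun q => by
    simp only [φ₀, AdjoinRoot.liftAlgHom_mk, Polynomial.aeval_def, Algebra.toRingHom_ofId]
  have hφ₀ : Function.Injective φ₀ := by
    rw [injective_iff_map_eq_zero]
    intro p hp
    obtain ⟨q, rfl⟩ := AdjoinRoot.mk_surjective p
    rw [hφ₀mk] at hp
    rw [AdjoinRoot.mk_eq_zero]
    exact hdvd q hp
  -- the standard-étale algebra `L = (R[X]/(f))[1/g]` and `ψ : L → Ω`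
  set r : AdjoinRoot fB := AdjoinRoot.mk fB gB with hr
  have hφ₀r : φ₀ r = Polynomial.aeval η gB := by rw [hr, hφ₀mk]
  have hrunit : IsUnit (φ₀ r) := by rw [hφ₀r]; exact isUnit_iff_ne_zero.mpr hgη0
  let L := Localization.Away r
  let ψ : L →ₐ[R] Ω := IsLocalization.Away.liftAlgHom r (f := φ₀) hrunit
  have hψalg : ∀ a : AdjoinRoot fB, ψ (algebraMap (AdjoinRoot fB) L a) = φ₀ a := fun a => by
    simp only [ψ, IsLocalization.Away.coe_liftAlgHom, IsLocalization.Away.lift_eq]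
    rfl
  have hnf : ∀ l : L, ∃ (q : Polynomial R) (n : ℕ),
      ψ l = Polynomial.aeval η q / Polynomial.aeval η gB ^ n := by
    intro l
    obtain ⟨⟨a, m⟩, hlm⟩ := IsLocalization.surj (Submonoid.powers r) l
    obtain ⟨n, hn⟩ := (Submonoid.mem_powers_iff _ _).mp m.2
    obtain ⟨q, rfl⟩ := AdjoinRoot.mk_surjective a
    refine ⟨q, n, ?_⟩
    have h1 : ψ l * Polynomial.aeval η gB ^ n = Polynomial.aeval η q := by
      have := congrArg ψ hlm
      rw [map_mul, hψalg, hψalg, hφ₀mk] at this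
      rw [← this, ← hn, map_pow, hφ₀r]
    rw [← h1, mul_div_assoc, div_self (pow_ne_zero n hgη0), mul_one]
  have hψ : Function.Injective ψ := by
    rw [injective_iff_map_eq_zero]
    intro l hl
    obtain ⟨⟨a, m⟩, hlm⟩ := IsLocalization.surj (Submonoid.powers r) l
    have h1 : φ₀ a = 0 := by
      have := congrArg ψ hlm
      rw [map_mul, hψalg, hψalg, hl, zero_mul] at this
      exact this.symm
    have ha : a = 0 := hφ₀ (by rw [h1, map_zero])
    rw [ha, map_zero] at hlm
    exact (IsLocalization.map_units L m).mul_left_eq_zero.mp hlm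
  -- `L` is standard étale over `R`; so is its image `A = ψ(L) ⊆ Ω`
  let SE : StandardEtalePair R :=
    { f := fB, monic_f := hfBmon, g := gB, cond := ⟨hB, p₂B, s, hidentB⟩ }
  haveI : Algebra.IsStandardEtale R L := Algebra.IsStandardEtale.of_equiv SE.equivAwayAdjoinRoot
  haveI : Algebra.Etale R L := inferInstance
  set A : Subalgebra R Ω := ψ.range
  let eA : L ≃ₐ[R] A := AlgEquiv.ofInjective ψ hψ
  have hetA : Algebra.Etale R A := Algebra.Etale.of_equiv eA
  have hmemA : ∀ w : Ω, w ∈ A ↔ ∃ l, ψ l = w := fun w => AlgHom.mem_range ψ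
  have hpolyA : ∀ q : Polynomial R, Polynomial.aeval η q ∈ A := fun q =>
    (hmemA _).mpr ⟨algebraMap _ L (AdjoinRoot.mk fB q), by rw [hψalg, hφ₀mk]⟩
  have hnumV : ∀ q : Polynomial R, Polynomial.aeval η q ∈ V := fun q => by
    rw [Polynomial.aeval_def, Polynomial.eval₂_eq_sum_range]
    exact V.toSubring.sum_mem fun k _ => V.toSubring.mul_mem (hRV _) (V.toSubring.pow_mem hηV k)
  have hgpowV : ∀ n : ℕ, (Polynomial.aeval η gB ^ n)⁻¹ ∈ V := fun n =>
    (V.valuation_le_one_iff _).mp (by rw [map_inv₀, map_pow, hvg, one_pow, inv_one])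
  have hAV : A.toSubring ≤ V.toSubring := by
    intro w hw
    obtain ⟨l, rfl⟩ := (hmemA w).mp hw
    obtain ⟨q, n, hq⟩ := hnf l
    rw [hq, div_eq_mul_inv]
    exact mul_mem (hnumV q) (hgpowV n)
  -- `g(η)⁻¹ ∈ A`: the image of the inverted `r`
  have hginvA : (Polynomial.aeval η gB)⁻¹ ∈ A := by
    have hru : IsUnit (algebraMap (AdjoinRoot fB) L r) :=
      IsLocalization.map_units L ⟨r, Submonoid.mem_powers r⟩
    refine (hmemA _).mpr ⟨((hru.unit⁻¹ : Lˣ) : L), ?_⟩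
    have h1 : ψ ((hru.unit⁻¹ : Lˣ) : L) * ψ (algebraMap (AdjoinRoot fB) L r) = 1 := by
      rw [← map_mul, IsUnit.val_inv_mul, map_one]
    rw [hψalg, hφ₀r] at h1
    exact eq_inv_of_mul_eq_one_left h1
  refine ⟨A, hAV, hetA, hpolyA, hginvA, fun w hw => ?_⟩
  obtain ⟨l, rfl⟩ := (hmemA w).mp hw
  exact hnf l

end Literature.AlgebraicGeometry.Resolution

end
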